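import Summits.QuantumFields.BalabanUV.Beta.CompositeOneShotJets
import Summits.QuantumFields.BalabanUV.Beta.BorderedHessianSymmetry

/-!
# `BalabanUV.Beta.FP.CompositeMixedEvenHalf` — road «FP», binder row D1 (LIBRARY fact about the row's object `CompositeMixedTable.compMixKer`):
# **THE EVEN HALF OF THE COMPOSITE MIXED KERNEL IS BLIND TO BOTH SECOND-ORDER BRICKS WHEN THE HESSIAN BRICK IS ANTISYMMETRIC**

WHAT.  `CompositeMixedTable.compMixKer ℓ 𝓋 𝒽 𝓉 L m μ y g f f′` (one background bond `g`, two fluctuation bonds `f f′`) is defined by the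
five-summand top-peeled chain rule (`compMixKer_succ`): S1 = top `𝓉` along three transported bonds; S2, S3 = top `𝒽` fed by the lower mixed
vertex in one fluctuation slot and the transported other bond (the CROSS WORDS); S4 = top `𝓋` fed by the lower composite Hessian
`compVHKer ℓ 𝒽`; S5 = top `ℓ` composed with the lower mixed kernel.  This file proves, for ANY bricks with `𝒽` ANTISYMMETRIC in its two
bond slots (`𝒽 m μ y b′ b = −𝒽 m μ y b b′` — a tree theorem for an1's rooted and (0.4)-symmetrised Hessian bricks:
`AveragingHessianKernelsRooted.hessKerAt_swap`, `SymAveragingHessianCounts.symHessKerAt_swap`):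
* §1 the zero second brick makes `compVHKer` vanish at every depth (its antisymmetry over an antisymmetric brick is an2's
  `CompositeHessianTable.compVHKer_swap`, re-used by name);
* §2 the cross words satisfy `S3(f,f′) = −S2(f′,f)`, so `S2 + S3` is `(f,f′)`-ODD and `S2 − S3 = S2(f,f′) + S2(f′,f)`; `S4` is `(f,f′)`-odd;
* §3 **`compMixKer_add_swap_of_hess_antisymm`**: the `(f,f′)`-EVEN half `compMixKer … g f f′ + compMixKer … g f′ f` equals the even half of
  the recursion with BOTH second-order bricks set to zero (`compMixKer ℓ 0 0 𝓉`: S1 + S5 only), at every depth; and `compMixKer ℓ 𝓋 0 𝓉 =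
  compMixKer ℓ 0 0 𝓉` pointwise (with `𝒽 = 0` the mixed brick `𝓋` never enters);
* §4 PACKED: `packFF K μ y + sgnK (trK (packFF K μ y)) = packFF (K + Kˢʷᵃᵖ) μ y` (by cases on the fibre legs), hence the even half
  `compMixFF … + sgnK (trK (compMixFF …))` — the shape the END's `hM₂` display periodises (v10 twin L.164, `½ • (mixFF + sgnK (trK mixFF))`) —
  equals that of the `𝓉`-only tower;
* §5 AT THE LITERAL's BRICKS: `CompositeOneShotJets.compMix r L m` (sym bricks) and the rooted-brick family — the antisymmetry letter
  discharged by name — so the literal's displayed `M₂` sees ONLY `symMixKerAt` transported by `symLinKerAt`, never `symHessKerAt` or `symVhKerAt`.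

WHY (located).  Engine C A2 locator (prestab/a2, R-AN2-80-GH ADD1 (P0′): `t_S23 = 0` exactly; ADD3 (P5): the cross word's OWN even half
`S2^e = ½(S2 + S2ᵀ)` evaluated at weight `108 = 2·54`); an2 g80 S-5 l.68966 (file:line reading «`compMix₂^e = S1^e + S5^e` for any data») and
J-4 l.68973 (3) («differs exactly by `(S2 − S3)^e`»); road FP g58 A-1 l.68971 (PREDICTION-FP-61) and INTENT-1 l.68974.  PRIOR ART IN THE TREE: an2
PART 32 `CombMixedT2EvenStoreyRec` §2 (`even_S23_eq_zero`, `even_S4_eq_zero`, `compMixKer_succ_even_eq`) IS the literal-level (d = 3, root `ctr 4 Lc`, `L = Lc`)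
ONE-STOREY form of §2∕§3 below; what this file adds is the brick-generic statement, the CLOSED identification with the `𝓉`-only tower `compMixKer ℓ 0 0 𝓉`
as an object at every depth, the packed `K + sgnK (trK K)` ∕ `½ •` shapes the END's `hM₂` display reads, and the rooted family.  This file makes the
reading a kernel theorem BEFORE the (P5) number; it does NOT say which object `hM₂` SHOULD display (the row's (C1) display question), defines
nothing, touches neither v10 nor the END nor M‴, values nothing.

[folklore] finite-sum bookkeeping over OUR typed objects; no `def`, no `def … : Prop`, nothing cited, 0 sorry.  Nothing of Bałaban's
asserted, valued or discharged; 0 estimates; 0∕4 row-D1 binders (hW ∕ hR ∕ D1Tel ∕ D1Rep); NOT (C1), NOT D1, NEVER «G-an2-4 closed»,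
NOT BetaPertH, NOT continuum, NOT Clay.
HONEST DEPENDENCY (page 1, mandatory): continuum YM on T⁴ ⇐ BetaPertH ∧ nine spine estimates (0/9 proved); BetaPertH ⇐ (D1) ∧
(D4) ∧ CAP+tail; G-an2-4 gates asym, D1 and NE2/3/4.  Road «FP» OWNER, b2b-balaban-beta-d1-p3 gen 58, 2026-08-29.  No existing file touched.
-/

noncomputable section

open scoped BigOperators

namespace Summit.QuantumFields.BalabanUV.Beta.FP.CompositeMixedEvenHalf

open Finset
open Literature.MathematicalPhysics.QuantumFieldTheory.Balaban1983to89
open Literature.MathematicalPhysics.QuantumFieldTheory.Balaban1983to89.Beta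
open AffineAveraging (Site box toSite)
open AveragingHessianKernels (Bond)
open AveragingHessianKernelsRooted (linKerAt vhKerAt hessKerAt hessKerAt_swap)
open AveragingMixedJetTables (mixKerAt)
open ExpKernelCalculus (MKer)
open OneStepResolventKernel (Fib)
open Summit.QuantumFields.BalabanUV.Beta.CompositeVertexKernelRec (offs compLinKer compVHKer compVHKer_zero compVHKer_succ)
open Summit.QuantumFields.BalabanUV.Beta.CompositeMixedTable (compMixKer compMixFF compMixKer_zero compMixKer_succ)
open Summit.QuantumFields.BalabanUV.Beta.CompositeHessianTable (packFF packFF_inl_inl packFF_inl_inr packFF_inr sum_window_pair_comm compVHKer_swap)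
open Summit.QuantumFields.BalabanUV.Beta.TameKernelCalculus (trK trK_apply)
open Summit.QuantumFields.BalabanUV.Beta.BorderedHessian (sgnK sgnK_apply sgnF sgnF_inl sgnF_inr)
open Summit.QuantumFields.BalabanUV.Beta.CompositeOneShotJets (compMix)
open Summit.QuantumFields.BalabanUV.Beta.SymAveragingHessianCounts (symLinKerAt symVhKerAt symHessKerAt symHessKerAt_swap)
open Summit.QuantumFields.BalabanUV.Beta.SymAveragingMixedJetTables (symMixKerAt)

variable {d : ℕ}

section Kernel

variable {ℓ : ℕ → Fin (d + 1) → Site (d + 1) → Bond (d + 1) → ℝ}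
  {𝓋 𝒽 : ℕ → Fin (d + 1) → Site (d + 1) → Bond (d + 1) → Bond (d + 1) → ℝ}
  {𝓉 : ℕ → Fin (d + 1) → Site (d + 1) → Bond (d + 1) → Bond (d + 1) → Bond (d + 1) → ℝ} {L : ℕ}

/-! ## §1 The composite second-order kernel over the zero brick vanishes (its antisymmetry over an antisymmetric brick is `CompositeHessianTable.compVHKer_swap`) -/

/-- [folklore] **THE ZERO SECOND BRICK GIVES THE ZERO COMPOSITE SECOND-ORDER KERNEL** at every depth. -/
theorem compVHKer_brick_zero :
    ∀ (m : ℕ) (μ : Fin (d + 1)) (y : Site (d + 1)) (f f' : Bond (d + 1)), compVHKer ℓ 0 L m μ y f f' = 0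
  | 0, μ, y, f, f' => compVHKer_zero μ y f f'
  | m + 1, μ, y, f, f' => by
      rw [compVHKer_succ]
      simp only [Pi.zero_apply, zero_mul, Finset.sum_const_zero, zero_add, compVHKer_brick_zero m, mul_zero]

/-! ## §2 The cross words of `compMixKer_succ` under an antisymmetric Hessian brick -/

/-- [folklore] **THE SECOND CROSS WORD IS MINUS THE SWAPPED FIRST**: with `𝒽` antisymmetric,
`S3(f,f′) = Σ 𝒽(b₁,b₂)·ℓ(f,b₁)·compVHKer ℓ 𝓋 (b₂; f′, g) = −Σ 𝒽(b₁,b₂)·compVHKer ℓ 𝓋 (b₁; f′, g)·ℓ(f, b₂) = −S2(f′,f)` (re-index by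
`CompositeHessianTable.sum_window_pair_comm`). -/
theorem cross₃_eq_neg_cross₂_swap (h𝒽 : ∀ m μ y b b', 𝒽 m μ y b' b = -𝒽 m μ y b b') (m : ℕ) (μ : Fin (d + 1)) (y : Site (d + 1))
    (g f f' : Bond (d + 1)) :
    (∑ κ₁ : Fin (d + 1), ∑ e₁ ∈ offs L, ∑ κ₂ : Fin (d + 1), ∑ e₂ ∈ offs L,
        𝒽 m μ y (κ₁, (L : ℤ) • y + e₁) (κ₂, (L : ℤ) • y + e₂)
          * compLinKer ℓ L m f (κ₁, (L : ℤ) • y + e₁) * compVHKer ℓ 𝓋 L m κ₂ ((L : ℤ) • y + e₂) f' g)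
      = -(∑ κ₁ : Fin (d + 1), ∑ e₁ ∈ offs L, ∑ κ₂ : Fin (d + 1), ∑ e₂ ∈ offs L,
          𝒽 m μ y (κ₁, (L : ℤ) • y + e₁) (κ₂, (L : ℤ) • y + e₂)
            * compVHKer ℓ 𝓋 L m κ₁ ((L : ℤ) • y + e₁) f' g * compLinKer ℓ L m f (κ₂, (L : ℤ) • y + e₂)) := by
  rw [sum_window_pair_comm (L := L) (fun κ₁ e₁ κ₂ e₂ => 𝒽 m μ y (κ₁, (L : ℤ) • y + e₁) (κ₂, (L : ℤ) • y + e₂)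
      * compLinKer ℓ L m f (κ₁, (L : ℤ) • y + e₁) * compVHKer ℓ 𝓋 L m κ₂ ((L : ℤ) • y + e₂) f' g)]
  simp only [← Finset.sum_neg_distrib]
  refine Finset.sum_congr rfl fun κ₂ _ => Finset.sum_congr rfl fun e₂ _ =>
    Finset.sum_congr rfl fun κ₁ _ => Finset.sum_congr rfl fun e₁ _ => ?_
  rw [h𝒽 m μ y (κ₂, (L : ℤ) • y + e₂) (κ₁, (L : ℤ) • y + e₁)]
  ring

/-- [folklore] **THE CROSS WORDS ARE `(f, f′)`-ODD**: `S2(f,f′) + S3(f,f′) + (S2(f′,f) + S3(f′,f)) = 0` under an antisymmetric `𝒽`. -/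
theorem cross_add_cross_swap_eq_zero (h𝒽 : ∀ m μ y b b', 𝒽 m μ y b' b = -𝒽 m μ y b b') (m : ℕ) (μ : Fin (d + 1)) (y : Site (d + 1))
    (g f f' : Bond (d + 1)) :
    ((∑ κ₁ : Fin (d + 1), ∑ e₁ ∈ offs L, ∑ κ₂ : Fin (d + 1), ∑ e₂ ∈ offs L,
        𝒽 m μ y (κ₁, (L : ℤ) • y + e₁) (κ₂, (L : ℤ) • y + e₂)
          * compVHKer ℓ 𝓋 L m κ₁ ((L : ℤ) • y + e₁) f g * compLinKer ℓ L m f' (κ₂, (L : ℤ) • y + e₂))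
      + (∑ κ₁ : Fin (d + 1), ∑ e₁ ∈ offs L, ∑ κ₂ : Fin (d + 1), ∑ e₂ ∈ offs L,
        𝒽 m μ y (κ₁, (L : ℤ) • y + e₁) (κ₂, (L : ℤ) • y + e₂)
          * compLinKer ℓ L m f (κ₁, (L : ℤ) • y + e₁) * compVHKer ℓ 𝓋 L m κ₂ ((L : ℤ) • y + e₂) f' g))
      + ((∑ κ₁ : Fin (d + 1), ∑ e₁ ∈ offs L, ∑ κ₂ : Fin (d + 1), ∑ e₂ ∈ offs L,
          𝒽 m μ y (κ₁, (L : ℤ) • y + e₁) (κ₂, (L : ℤ) • y + e₂)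
            * compVHKer ℓ 𝓋 L m κ₁ ((L : ℤ) • y + e₁) f' g * compLinKer ℓ L m f (κ₂, (L : ℤ) • y + e₂))
        + (∑ κ₁ : Fin (d + 1), ∑ e₁ ∈ offs L, ∑ κ₂ : Fin (d + 1), ∑ e₂ ∈ offs L,
          𝒽 m μ y (κ₁, (L : ℤ) • y + e₁) (κ₂, (L : ℤ) • y + e₂)
            * compLinKer ℓ L m f' (κ₁, (L : ℤ) • y + e₁) * compVHKer ℓ 𝓋 L m κ₂ ((L : ℤ) • y + e₂) f g)) = 0 := by
  rw [cross₃_eq_neg_cross₂_swap h𝒽 m μ y g f f', cross₃_eq_neg_cross₂_swap h𝒽 m μ y g f' f]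
  ring

/-- [folklore] **THE SYMMETRIC CROSS WORD**: under an antisymmetric `𝒽`, `S2(f,f′) − S3(f,f′) = S2(f,f′) + S2(f′,f)` — the `(f,f′)`-symmetrisation
of `S2` (twice its even half; the word Engine C's (P5) evaluates, not a member of `compMixKer`'s even half). -/
theorem cross₂_sub_cross₃_eq (h𝒽 : ∀ m μ y b b', 𝒽 m μ y b' b = -𝒽 m μ y b b') (m : ℕ) (μ : Fin (d + 1)) (y : Site (d + 1))
    (g f f' : Bond (d + 1)) :
    (∑ κ₁ : Fin (d + 1), ∑ e₁ ∈ offs L, ∑ κ₂ : Fin (d + 1), ∑ e₂ ∈ offs L,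
        𝒽 m μ y (κ₁, (L : ℤ) • y + e₁) (κ₂, (L : ℤ) • y + e₂)
          * compVHKer ℓ 𝓋 L m κ₁ ((L : ℤ) • y + e₁) f g * compLinKer ℓ L m f' (κ₂, (L : ℤ) • y + e₂))
      - (∑ κ₁ : Fin (d + 1), ∑ e₁ ∈ offs L, ∑ κ₂ : Fin (d + 1), ∑ e₂ ∈ offs L,
        𝒽 m μ y (κ₁, (L : ℤ) • y + e₁) (κ₂, (L : ℤ) • y + e₂)
          * compLinKer ℓ L m f (κ₁, (L : ℤ) • y + e₁) * compVHKer ℓ 𝓋 L m κ₂ ((L : ℤ) • y + e₂) f' g)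
      = (∑ κ₁ : Fin (d + 1), ∑ e₁ ∈ offs L, ∑ κ₂ : Fin (d + 1), ∑ e₂ ∈ offs L,
          𝒽 m μ y (κ₁, (L : ℤ) • y + e₁) (κ₂, (L : ℤ) • y + e₂)
            * compVHKer ℓ 𝓋 L m κ₁ ((L : ℤ) • y + e₁) f g * compLinKer ℓ L m f' (κ₂, (L : ℤ) • y + e₂))
        + (∑ κ₁ : Fin (d + 1), ∑ e₁ ∈ offs L, ∑ κ₂ : Fin (d + 1), ∑ e₂ ∈ offs L,
          𝒽 m μ y (κ₁, (L : ℤ) • y + e₁) (κ₂, (L : ℤ) • y + e₂)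
            * compVHKer ℓ 𝓋 L m κ₁ ((L : ℤ) • y + e₁) f' g * compLinKer ℓ L m f (κ₂, (L : ℤ) • y + e₂)) := by
  rw [cross₃_eq_neg_cross₂_swap h𝒽 m μ y g f f', sub_neg_eq_add]

/-- [folklore] **THE `𝓋`-FED WORD IS `(f, f′)`-ODD**: `S4(f,f′) + S4(f′,f) = 0` — its lower composite Hessian `compVHKer ℓ 𝒽` is antisymmetric
by `CompositeHessianTable.compVHKer_swap` applied to the brick `𝒽`. -/
theorem vWord_add_vWord_swap_eq_zero (h𝒽 : ∀ m μ y b b', 𝒽 m μ y b' b = -𝒽 m μ y b b') (m : ℕ) (μ : Fin (d + 1)) (y : Site (d + 1))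
    (g f f' : Bond (d + 1)) :
    (∑ κ₁ : Fin (d + 1), ∑ e₁ ∈ offs L, ∑ κ : Fin (d + 1), ∑ e ∈ offs L,
        𝓋 m μ y (κ₁, (L : ℤ) • y + e₁) (κ, (L : ℤ) • y + e)
          * compVHKer ℓ 𝒽 L m κ₁ ((L : ℤ) • y + e₁) f f' * compLinKer ℓ L m g (κ, (L : ℤ) • y + e))
      + (∑ κ₁ : Fin (d + 1), ∑ e₁ ∈ offs L, ∑ κ : Fin (d + 1), ∑ e ∈ offs L,
        𝓋 m μ y (κ₁, (L : ℤ) • y + e₁) (κ, (L : ℤ) • y + e)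
          * compVHKer ℓ 𝒽 L m κ₁ ((L : ℤ) • y + e₁) f' f * compLinKer ℓ L m g (κ, (L : ℤ) • y + e)) = 0 := by
  rw [← Finset.sum_add_distrib]
  refine Finset.sum_eq_zero fun κ₁ _ => ?_
  rw [← Finset.sum_add_distrib]
  refine Finset.sum_eq_zero fun e₁ _ => ?_
  rw [← Finset.sum_add_distrib]
  refine Finset.sum_eq_zero fun κ _ => ?_
  rw [← Finset.sum_add_distrib]
  refine Finset.sum_eq_zero fun e _ => ?_
  rw [compVHKer_swap h𝒽 m κ₁ ((L : ℤ) • y + e₁) f f']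
  ring

/-! ## §3 The even half of the composite mixed kernel is blind to `𝓋` and `𝒽` -/

/-- [folklore] **WITH THE ZERO HESSIAN BRICK THE MIXED BRICK NEVER ENTERS**: `compMixKer ℓ 𝓋 0 𝓉 = compMixKer ℓ 0 0 𝓉` pointwise, at every depth
(S2, S3 carry the factor `𝒽 = 0`; S4 carries `compVHKer ℓ 0 = 0`). -/
theorem compMixKer_hess_zero :
    ∀ (m : ℕ) (μ : Fin (d + 1)) (y : Site (d + 1)) (g f f' : Bond (d + 1)),
      compMixKer ℓ 𝓋 0 𝓉 L m μ y g f f' = compMixKer ℓ 0 0 𝓉 L m μ y g f f'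
  | 0, μ, y, g, f, f' => by rw [compMixKer_zero, compMixKer_zero]
  | m + 1, μ, y, g, f, f' => by
      rw [compMixKer_succ, compMixKer_succ]
      simp only [Pi.zero_apply, zero_mul, Finset.sum_const_zero, add_zero, compVHKer_brick_zero m, mul_zero,
        compMixKer_hess_zero m]

/-- [folklore] **THE EVEN HALF OF THE COMPOSITE MIXED KERNEL IS BLIND TO BOTH SECOND-ORDER BRICKS WHEN THE HESSIAN BRICK IS ANTISYMMETRIC**:
for every depth `m`, `compMixKer ℓ 𝓋 𝒽 𝓉 L m μ y g f f′ + compMixKer ℓ 𝓋 𝒽 𝓉 L m μ y g f′ f = compMixKer ℓ 0 0 𝓉 L m μ y g f f′ +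
compMixKer ℓ 0 0 𝓉 L m μ y g f′ f` — only S1 (`𝓉` along three transported bonds) and S5 (`ℓ` ∘ lower) reach the even half; the cross words
(§2) and the `𝓋`-fed word cancel. -/
theorem compMixKer_add_swap_of_hess_antisymm (h𝒽 : ∀ m μ y b b', 𝒽 m μ y b' b = -𝒽 m μ y b b') :
    ∀ (m : ℕ) (μ : Fin (d + 1)) (y : Site (d + 1)) (g f f' : Bond (d + 1)),
      compMixKer ℓ 𝓋 𝒽 𝓉 L m μ y g f f' + compMixKer ℓ 𝓋 𝒽 𝓉 L m μ y g f' f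
        = compMixKer ℓ 0 0 𝓉 L m μ y g f f' + compMixKer ℓ 0 0 𝓉 L m μ y g f' f
  | 0, μ, y, g, f, f' => by simp only [compMixKer_zero]
  | m + 1, μ, y, g, f, f' => by
      have h23 := cross_add_cross_swap_eq_zero (ℓ := ℓ) (𝓋 := 𝓋) (L := L) h𝒽 m μ y g f f'
      have h4 := vWord_add_vWord_swap_eq_zero (ℓ := ℓ) (𝓋 := 𝓋) (L := L) h𝒽 m μ y g f f'
      have h5 : (∑ κ : Fin (d + 1), ∑ e ∈ offs L,
            ℓ m μ y (κ, (L : ℤ) • y + e) * compMixKer ℓ 𝓋 𝒽 𝓉 L m κ ((L : ℤ) • y + e) g f f')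
          + (∑ κ : Fin (d + 1), ∑ e ∈ offs L,
            ℓ m μ y (κ, (L : ℤ) • y + e) * compMixKer ℓ 𝓋 𝒽 𝓉 L m κ ((L : ℤ) • y + e) g f' f)
          = (∑ κ : Fin (d + 1), ∑ e ∈ offs L,
            ℓ m μ y (κ, (L : ℤ) • y + e) * compMixKer ℓ 0 0 𝓉 L m κ ((L : ℤ) • y + e) g f f')
          + (∑ κ : Fin (d + 1), ∑ e ∈ offs L,
            ℓ m μ y (κ, (L : ℤ) • y + e) * compMixKer ℓ 0 0 𝓉 L m κ ((L : ℤ) • y + e) g f' f) := by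
        rw [← Finset.sum_add_distrib, ← Finset.sum_add_distrib]
        refine Finset.sum_congr rfl fun κ _ => ?_
        rw [← Finset.sum_add_distrib, ← Finset.sum_add_distrib]
        refine Finset.sum_congr rfl fun e _ => ?_
        rw [← mul_add, ← mul_add, compMixKer_add_swap_of_hess_antisymm h𝒽 m]
      rw [compMixKer_succ, compMixKer_succ, compMixKer_succ, compMixKer_succ]
      simp only [Pi.zero_apply, zero_mul, Finset.sum_const_zero, add_zero, compVHKer_brick_zero m, mul_zero]
      linear_combination h23 + h4 + h5

/-- [folklore] The same with the `𝓋` brick kept on the right (`compMixKer_hess_zero`): the even half depends on `𝒽` only through nothing. -/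
theorem compMixKer_add_swap_of_hess_antisymm' (h𝒽 : ∀ m μ y b b', 𝒽 m μ y b' b = -𝒽 m μ y b b') (m : ℕ) (μ : Fin (d + 1))
    (y : Site (d + 1)) (g f f' : Bond (d + 1)) :
    compMixKer ℓ 𝓋 𝒽 𝓉 L m μ y g f f' + compMixKer ℓ 𝓋 𝒽 𝓉 L m μ y g f' f
      = compMixKer ℓ 𝓋 0 𝓉 L m μ y g f f' + compMixKer ℓ 𝓋 0 𝓉 L m μ y g f' f := by
  rw [compMixKer_hess_zero (𝓋 := 𝓋) m μ y g f f', compMixKer_hess_zero (𝓋 := 𝓋) m μ y g f' f]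
  exact compMixKer_add_swap_of_hess_antisymm h𝒽 m μ y g f f'

/-! ## §4 Packed: the even half `K + sgnK (trK K)` of the packed composite mixed table -/

/-- [folklore] **THE EVEN HALF OF A PACKED FIELD–FIELD TABLE IS THE PACKING OF THE SWAP-SYMMETRISED KERNEL**:
`packFF K μ y + sgnK (trK (packFF K μ y)) = packFF (fun μ y f f′ ↦ K μ y f f′ + K μ y f′ f) μ y` (by cases on the fibre legs; the packer is
zero on every block touching a multiplier index, and `sgnF (inl _) = 1`). -/
theorem packFF_add_sgnK_trK (K : Fin (d + 1) → Site (d + 1) → Bond (d + 1) → Bond (d + 1) → ℝ) (μ : Fin (d + 1)) (y : Site (d + 1)) :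
    packFF K μ y + sgnK (trK (packFF K μ y)) = packFF (fun μ y f f' => K μ y f f' + K μ y f' f) μ y := by
  funext x x' a b
  rw [Pi.add_apply, Pi.add_apply, Pi.add_apply, Pi.add_apply, sgnK_apply, trK_apply]
  rcases a with α | ν <;> rcases b with α' | ν'
  · rw [packFF_inl_inl, packFF_inl_inl, packFF_inl_inl, sgnF_inl, sgnF_inl, one_mul, one_mul]
  · rw [packFF_inl_inr, packFF_inl_inr, packFF_inr, mul_zero, add_zero]
  · rw [packFF_inr, packFF_inr, packFF_inl_inr, mul_zero, add_zero]
  · rw [packFF_inr, packFF_inr, packFF_inr, mul_zero, add_zero]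

/-- [folklore] **THE EVEN HALF OF THE PACKED COMPOSITE MIXED TABLE IS THAT OF THE `𝓉`-ONLY TOWER** (antisymmetric `𝒽`):
`compMixFF ℓ 𝓋 𝒽 𝓉 L m κ u μ y + sgnK (trK (·)) = compMixFF ℓ 0 0 𝓉 L m κ u μ y + sgnK (trK (·))`. -/
theorem compMixFF_add_sgnK_trK_of_hess_antisymm (h𝒽 : ∀ m μ y b b', 𝒽 m μ y b' b = -𝒽 m μ y b b') (m : ℕ) (κ : Fin (d + 1))
    (u : Site (d + 1)) (μ : Fin (d + 1)) (y : Site (d + 1)) :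
    compMixFF ℓ 𝓋 𝒽 𝓉 L m κ u μ y + sgnK (trK (compMixFF ℓ 𝓋 𝒽 𝓉 L m κ u μ y))
      = compMixFF ℓ 0 0 𝓉 L m κ u μ y + sgnK (trK (compMixFF ℓ 0 0 𝓉 L m κ u μ y)) := by
  unfold compMixFF
  rw [packFF_add_sgnK_trK, packFF_add_sgnK_trK]
  congr 1
  funext μ' y' f f'
  exact compMixKer_add_swap_of_hess_antisymm h𝒽 m μ' y' (κ, u) f f'

/-- [folklore] The same in the `½ • (K + sgnK (trK K))` shape the END's `hM₂` display periodises. -/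
theorem compMixFF_evenHalf_of_hess_antisymm (h𝒽 : ∀ m μ y b b', 𝒽 m μ y b' b = -𝒽 m μ y b b') (m : ℕ) (κ : Fin (d + 1))
    (u : Site (d + 1)) (μ : Fin (d + 1)) (y : Site (d + 1)) :
    (1 / 2 : ℝ) • (compMixFF ℓ 𝓋 𝒽 𝓉 L m κ u μ y + sgnK (trK (compMixFF ℓ 𝓋 𝒽 𝓉 L m κ u μ y)))
      = (1 / 2 : ℝ) • (compMixFF ℓ 0 0 𝓉 L m κ u μ y + sgnK (trK (compMixFF ℓ 0 0 𝓉 L m κ u μ y))) := by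
  rw [compMixFF_add_sgnK_trK_of_hess_antisymm h𝒽]

end Kernel

/-! ## §5 At the literal's bricks: the antisymmetry letter discharged by name -/

section Literal

/-- [folklore] **THE (0.4)-SYMMETRISED COMPOSITE MIXED TABLE's EVEN HALF SEES ONLY `symMixKerAt` TRANSPORTED BY `symLinKerAt`**
(`CompositeOneShotJets.compMix r L m` = `compMixFF` over `(symLinKerAt, symVhKerAt, symHessKerAt, symMixKerAt) (toSite r) L`; antisymmetry of the
Hessian brick = `SymAveragingHessianCounts.symHessKerAt_swap`) — at every depth `m`, every background bond `(κ, u)`, every level-`m` bond `(μ, y)`. -/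
theorem compMix_add_sgnK_trK (r : Fin (d + 1) → ℕ) (L m : ℕ) (κ : Fin (d + 1)) (u : Site (d + 1)) (μ : Fin (d + 1)) (y : Site (d + 1)) :
    compMix r L m κ u μ y + sgnK (trK (compMix r L m κ u μ y))
      = compMixFF (fun _ => symLinKerAt (toSite r) L) 0 0 (fun _ => symMixKerAt (toSite r) L) L m κ u μ y
        + sgnK (trK (compMixFF (fun _ => symLinKerAt (toSite r) L) 0 0 (fun _ => symMixKerAt (toSite r) L) L m κ u μ y)) :=
  compMixFF_add_sgnK_trK_of_hess_antisymm (ℓ := fun _ => symLinKerAt (toSite r) L) (𝓋 := fun _ => symVhKerAt (toSite r) L)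
    (𝒽 := fun _ => symHessKerAt (toSite r) L) (𝓉 := fun _ => symMixKerAt (toSite r) L)
    (fun _ μ y b b' => symHessKerAt_swap (toSite r) L μ y b b') m κ u μ y

/-- [folklore] The same in the `½ •` shape. -/
theorem compMix_evenHalf (r : Fin (d + 1) → ℕ) (L m : ℕ) (κ : Fin (d + 1)) (u : Site (d + 1)) (μ : Fin (d + 1)) (y : Site (d + 1)) :
    (1 / 2 : ℝ) • (compMix r L m κ u μ y + sgnK (trK (compMix r L m κ u μ y)))
      = (1 / 2 : ℝ) • (compMixFF (fun _ => symLinKerAt (toSite r) L) 0 0 (fun _ => symMixKerAt (toSite r) L) L m κ u μ y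
        + sgnK (trK (compMixFF (fun _ => symLinKerAt (toSite r) L) 0 0 (fun _ => symMixKerAt (toSite r) L) L m κ u μ y))) := by
  rw [compMix_add_sgnK_trK]

/-- [folklore] The kernel-level statement at the (0.4)-symmetrised bricks. -/
theorem compMixKer_sym_add_swap (r : Fin (d + 1) → ℕ) (L m : ℕ) (μ : Fin (d + 1)) (y : Site (d + 1)) (g f f' : Bond (d + 1)) :
    compMixKer (fun _ => symLinKerAt (toSite r) L) (fun _ => symVhKerAt (toSite r) L) (fun _ => symHessKerAt (toSite r) L)
        (fun _ => symMixKerAt (toSite r) L) L m μ y g f f'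
      + compMixKer (fun _ => symLinKerAt (toSite r) L) (fun _ => symVhKerAt (toSite r) L) (fun _ => symHessKerAt (toSite r) L)
        (fun _ => symMixKerAt (toSite r) L) L m μ y g f' f
      = compMixKer (fun _ => symLinKerAt (toSite r) L) 0 0 (fun _ => symMixKerAt (toSite r) L) L m μ y g f f'
        + compMixKer (fun _ => symLinKerAt (toSite r) L) 0 0 (fun _ => symMixKerAt (toSite r) L) L m μ y g f' f :=
  compMixKer_add_swap_of_hess_antisymm (ℓ := fun _ => symLinKerAt (toSite r) L) (𝓋 := fun _ => symVhKerAt (toSite r) L)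
    (𝒽 := fun _ => symHessKerAt (toSite r) L) (𝓉 := fun _ => symMixKerAt (toSite r) L)
    (fun _ μ y b b' => symHessKerAt_swap (toSite r) L μ y b b') m μ y g f f'

/-- [folklore] **THE ROOTED-BRICK FAMILY** (per-level roots `r k`; antisymmetry = `AveragingHessianKernelsRooted.hessKerAt_swap`): the packed even half
of `compMixFF (linKerAt) (vhKerAt) (hessKerAt) (mixKerAt)` is that of `compMixFF (linKerAt) 0 0 (mixKerAt)`. -/
theorem compMixFF_rooted_add_sgnK_trK (r : ℕ → (Fin (d + 1) → ℕ)) (L m : ℕ) (κ : Fin (d + 1)) (u : Site (d + 1)) (μ : Fin (d + 1))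
    (y : Site (d + 1)) :
    compMixFF (fun k => linKerAt (toSite (r k)) L) (fun k => vhKerAt (toSite (r k)) L) (fun k => hessKerAt (toSite (r k)) L)
        (fun k => mixKerAt (toSite (r k)) L) L m κ u μ y
      + sgnK (trK (compMixFF (fun k => linKerAt (toSite (r k)) L) (fun k => vhKerAt (toSite (r k)) L) (fun k => hessKerAt (toSite (r k)) L)
        (fun k => mixKerAt (toSite (r k)) L) L m κ u μ y))
      = compMixFF (fun k => linKerAt (toSite (r k)) L) 0 0 (fun k => mixKerAt (toSite (r k)) L) L m κ u μ y
        + sgnK (trK (compMixFF (fun k => linKerAt (toSite (r k)) L) 0 0 (fun k => mixKerAt (toSite (r k)) L) L m κ u μ y)) :=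
  compMixFF_add_sgnK_trK_of_hess_antisymm (ℓ := fun k => linKerAt (toSite (r k)) L) (𝓋 := fun k => vhKerAt (toSite (r k)) L)
    (𝒽 := fun k => hessKerAt (toSite (r k)) L) (𝓉 := fun k => mixKerAt (toSite (r k)) L)
    (fun k μ y b b' => hessKerAt_swap (toSite (r k)) L μ y b b') m κ u μ y

end Literal

end Summit.QuantumFields.BalabanUV.Beta.FP.CompositeMixedEvenHalf

end
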